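import Summits.HodgeConjecture.HodgeConjecture.Theses.AnchorTransport
import Summits.HodgeConjecture.HodgeConjecture.Theorems.AnchorTransportVariationalHodgeReductions
import Summits.HodgeConjecture.HodgeConjecture.Theorems.AnchorTransportVariationalHodgeLefschetzRange
import Literature.AlgebraicGeometry.Motives.CurveThroughTwoPoints

/-!
# Route AnchorTransport — `VariationalHodge` (stmt-HodgeConjecture-1076): reduction to one-dimensional bases

**The variational Hodge crux follows from its restriction to smooth irreducible affine CURVES** (bases of
topological Krull dimension `1`): `variationalHodge_of_curveBase`. This is the first lemma
(`CurveBaseReduction`) of the crux line `tame-symbol-splitting` (crux workfile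
`Cruxes/VariationalHodge/IdeatorOneSketch.lean`), whose engine works over the discrete valuation ring
of a curve at the anchor; every transport argument along a one-parameter family needs it.

Proof. By `variationalHodge_of_affine` the base `S` may be taken smooth, irreducible and affine (of
finite type over `ℂ`). If the target point `s` is the anchor `s₀` there is nothing to prove; otherwise
the two distinct complex points `s₀`, `s` lie on the image of a smooth irreducible affine curve
`g : C ⟶ S` (the classical lemma that two points of an irreducible variety lie on an irreducible curve —
Mumford, *Abelian Varieties*, §6 Lemma — followed by normalisation; the tree's named fact
`Motives.mumford_smoothCurve_through_two_points`, the one unproved input). Base-change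
the family along `g` (`Motives.familyPullback`: again a smooth projective family,
`IsSmoothProjectiveFamily.familyPullback_snd`), pull the global class back to `𝒳 ×_S C`; the fibrewise
hypotheses, the anchor and the conclusion move across the identification of the fibre of the base
change over `c` with the fibre of `f` over `g c` (`familyPullback_fibrewise_rational_hodgeType`,
`map_fiberι_familyPullback_mem_algebraicClasses_iff`, both proved in
`AnchorTransportVariationalHodgeReductions`).

The reduction is stated for bases of dimension EXACTLY `1` — the hypothesis shape
`VariationalHodgeCurveBase` of the crux workfile (plus affineness) — and `variationalHodge_of_residual`
combines it with the fibrewise Lefschetz range (`AnchorTransportVariationalHodgeLefschetzRange`): the crux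
follows from its instances with `n ≥ 4`, `2 ≤ p ≤ n - 2` over smooth irreducible affine curves.
-/

noncomputable section

-- every declaration of this problem lives in `Summit.HodgeConjecture.HodgeConjecture.…` (summit = sub-problem)
set_option linter.dupNamespace false

open CategoryTheory AlgebraicGeometry TopologicalSpace MonoidalCategory
open Literature.AlgebraicGeometry.Motives Literature.AlgebraicGeometry.HodgeTheory
open Summit.HodgeConjecture.HodgeConjecture.Theses.AnchorTransport

namespace Summit.HodgeConjecture.HodgeConjecture.Theorems

/-! ### Transport of one instance of the crux along a base change hitting anchor and target -/

/-- **One instance of the crux moves along any base change whose image contains the anchor and the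
target point.** If `g : S' ⟶ S` is a morphism of `ℂ`-schemes, `t₀, t ∈ S'(ℂ)` lie over `s₀, s`, and the
variational Hodge conclusion holds for the base-changed family `𝒳 ×_S S' ⟶ S'` and the pulled-back class
(from the anchor `t₀` to the point `t`), then it holds for `f` from `s₀` to `s`: hypotheses, anchor and
conclusion are transported by `familyPullback_fibrewise_rational_hodgeType` and
`map_fiberι_familyPullback_mem_algebraicClasses_iff`. [folklore] -/
theorem variationalHodge_conclusion_of_baseChange {n p : ℕ} {𝒳 S S' : SchemeOver ℂ} (f : 𝒳 ⟶ S)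
    (hf : IsSmoothProjectiveFamily f n) (g : S' ⟶ S) (A : complexBetti 𝒳 (2 * p))
    (hA : ∀ s : ComplexPoints S, IsRationalClass (complexBetti.map (fiberι f s) (2 * p) A) ∧
      IsOfHodgeType n (fiberOver f s) (2 * p) p p (complexBetti.map (fiberι f s) (2 * p) A))
    {s₀ s : ComplexPoints S} {t₀ t : ComplexPoints S'} (ht₀ : AlgPoints.map g t₀ = s₀)
    (ht : AlgPoints.map g t = s)
    (h : (∀ s' : ComplexPoints S',
        IsRationalClass (complexBetti.map (fiberι (familyPullback.snd f g) s') (2 * p)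
          (complexBetti.map (familyPullback.fst f g) (2 * p) A)) ∧
        IsOfHodgeType n (fiberOver (familyPullback.snd f g) s') (2 * p) p p
          (complexBetti.map (fiberι (familyPullback.snd f g) s') (2 * p)
            (complexBetti.map (familyPullback.fst f g) (2 * p) A))) →
      complexBetti.map (fiberι (familyPullback.snd f g) t₀) (2 * p)
          (complexBetti.map (familyPullback.fst f g) (2 * p) A) ∈
        algebraicClasses (fiberOver (familyPullback.snd f g) t₀) p →
      complexBetti.map (fiberι (familyPullback.snd f g) t) (2 * p)
          (complexBetti.map (familyPullback.fst f g) (2 * p) A) ∈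
        algebraicClasses (fiberOver (familyPullback.snd f g) t) p)
    (hs₀ : complexBetti.map (fiberι f s₀) (2 * p) A ∈ algebraicClasses (fiberOver f s₀) p) :
    complexBetti.map (fiberι f s) (2 * p) A ∈ algebraicClasses (fiberOver f s) p := by
  subst ht₀ ht
  exact (map_fiberι_familyPullback_mem_algebraicClasses_iff f g hf A t).1
    (h (familyPullback_fibrewise_rational_hodgeType f g A hA)
      ((map_fiberι_familyPullback_mem_algebraicClasses_iff f g hf A t₀).2 hs₀))

/-! ### Reduction to curve bases -/

/-- **Reduction to curve bases for `Q`-families** (`Q` any property of families stable under base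
change, e.g. `⊤` for the crux as filed, or relative projectivity for the printed conjecture). Granted the
named fact `mumford_smoothCurve_through_two_points` (Mumford's lemma + normalisation): if the
variational Hodge statement holds for `Q`-families over smooth irreducible AFFINE `ℂ`-schemes of
topological Krull dimension `1`, it holds for `Q`-families over every smooth irreducible `ℂ`-scheme:
reduce to an affine base (`variationalHodge_of_affine_of_stable`); if the target point is the anchor
there is nothing to do, otherwise join the anchor `s₀` to the target `s` by a smooth affine curve
`g : C ⟶ S` and transport along the base change (`variationalHodge_conclusion_of_baseChange`).
[cite: MumfordAV1970, §6 Lemma] -/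
theorem variationalHodge_of_curveBase_of_stable (hC : mumford_smoothCurve_through_two_points)
    (Q : ∀ ⦃𝒳 S : SchemeOver ℂ⦄, (𝒳 ⟶ S) → Prop)
    (hQ : ∀ ⦃𝒳 S S' : SchemeOver ℂ⦄ (f : 𝒳 ⟶ S) (g : S' ⟶ S), Q f → Q (familyPullback.snd f g))
    (h : ∀ ⦃n : ℕ⦄ ⦃𝒳 S : SchemeOver ℂ⦄ (f : 𝒳 ⟶ S), IsSmoothProjectiveFamily f n → Q f →
      IrreducibleSpace S.left → IsAffine S.left → AlgebraicGeometry.Smooth S.hom →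
      topologicalKrullDim S.left = 1 →
      ∀ (p : ℕ) (A : complexBetti 𝒳 (2 * p)),
      (∀ s : ComplexPoints S, IsRationalClass (complexBetti.map (fiberι f s) (2 * p) A) ∧
        IsOfHodgeType n (fiberOver f s) (2 * p) p p (complexBetti.map (fiberι f s) (2 * p) A)) →
      (∃ s₀ : ComplexPoints S,
        complexBetti.map (fiberι f s₀) (2 * p) A ∈ algebraicClasses (fiberOver f s₀) p) →
      ∀ s : ComplexPoints S,
        complexBetti.map (fiberι f s) (2 * p) A ∈ algebraicClasses (fiberOver f s) p)
    ⦃n : ℕ⦄ ⦃𝒳 S : SchemeOver ℂ⦄ (f : 𝒳 ⟶ S) (hf : IsSmoothProjectiveFamily f n) (hQf : Q f)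
    (hirr : IrreducibleSpace S.left) (hsm : AlgebraicGeometry.Smooth S.hom) (p : ℕ)
    (A : complexBetti 𝒳 (2 * p))
    (hA : ∀ s : ComplexPoints S, IsRationalClass (complexBetti.map (fiberι f s) (2 * p) A) ∧
      IsOfHodgeType n (fiberOver f s) (2 * p) p p (complexBetti.map (fiberι f s) (2 * p) A))
    (hs₀ : ∃ s₀ : ComplexPoints S,
      complexBetti.map (fiberι f s₀) (2 * p) A ∈ algebraicClasses (fiberOver f s₀) p)
    (s : ComplexPoints S) :
    complexBetti.map (fiberι f s) (2 * p) A ∈ algebraicClasses (fiberOver f s) p := by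
  refine variationalHodge_of_affine_of_stable Q (fun 𝒳 S S' f g _ hQf => hQ f g hQf)
    (fun n 𝒳 S f hf hQf hirr haff hsm p A hA hs₀ s => ?_) f hf hQf hirr hsm p A hA hs₀ s
  obtain ⟨s₀, hs₀⟩ := hs₀
  by_cases hs : s₀ = s
  · exact hs ▸ hs₀
  haveI := hirr
  haveI := haff
  haveI := hsm
  obtain ⟨C, g, t₀, t, hCaff, hCirr, hCsm, hCdim, ht₀, ht⟩ := hC.of_irreducibleSpace s₀ s hs
  exact variationalHodge_conclusion_of_baseChange f hf g A hA ht₀ ht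
    (fun hA' ht₀' => h (familyPullback.snd f g) (hf.familyPullback_snd g) (hQ f g hQf) hCirr hCaff hCsm
      hCdim p (complexBetti.map (familyPullback.fst f g) (2 * p) A) hA' ⟨t₀, ht₀'⟩ t) hs₀

/-- **The crux reduces to smooth irreducible affine curve bases.** Granted the named fact
`mumford_smoothCurve_through_two_points` (Mumford's lemma + normalisation), if Grothendieck's
variational Hodge statement holds for smooth projective families over smooth irreducible AFFINE
`ℂ`-schemes of topological Krull dimension `1`, it holds over every smooth irreducible `ℂ`-scheme
(`variationalHodge_of_curveBase_of_stable` with `Q = ⊤`). The hypothesis is `VariationalHodgeCurveBase`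
of the crux workfile `Cruxes/VariationalHodge/IdeatorOneSketch.lean` with affineness added (harmless
for a consumer proving the curve statement): this is its `CurveBaseReduction`.
[cite: MumfordAV1970, §6 Lemma] -/
theorem variationalHodge_of_curveBase (hC : mumford_smoothCurve_through_two_points)
    (h : ∀ ⦃n : ℕ⦄ ⦃𝒳 S : SchemeOver ℂ⦄ (f : 𝒳 ⟶ S), IsSmoothProjectiveFamily f n →
      IrreducibleSpace S.left → IsAffine S.left → AlgebraicGeometry.Smooth S.hom →
      topologicalKrullDim S.left = 1 →
      ∀ (p : ℕ) (A : complexBetti 𝒳 (2 * p)),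
      (∀ s : ComplexPoints S, IsRationalClass (complexBetti.map (fiberι f s) (2 * p) A) ∧
        IsOfHodgeType n (fiberOver f s) (2 * p) p p (complexBetti.map (fiberι f s) (2 * p) A)) →
      (∃ s₀ : ComplexPoints S,
        complexBetti.map (fiberι f s₀) (2 * p) A ∈ algebraicClasses (fiberOver f s₀) p) →
      ∀ s : ComplexPoints S,
        complexBetti.map (fiberι f s) (2 * p) A ∈ algebraicClasses (fiberOver f s) p) :
    VariationalHodge :=
  fun _ _ _ f hf hirr hsm p A hA hs₀ s =>
    variationalHodge_of_curveBase_of_stable hC (fun _ _ _ => True) (fun _ _ _ _ _ _ => trivial)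
      (fun _ _ _ f hf _ hirr haff hsm hdim => h f hf hirr haff hsm hdim) f hf trivial hirr hsm p A hA
      hs₀ s

/-- **The printed (projective) form reduces to curve bases as well**: for PROJECTIVE smooth families
(`f` a closed immersion into `ℙᴺ × S` followed by the projection — the hypothesis shape of
Charles–Schnell Conj. 11.3.1 and of the tree's `Andre1996_deformation`, stable under base change by
`Motives.exists_isClosedImmersion_familyPullback`), the variational Hodge statement over smooth
irreducible affine curve bases gives it over every smooth irreducible base, granted
`mumford_smoothCurve_through_two_points`. [cite: MumfordAV1970, §6 Lemma] -/
theorem variationalHodge_projective_of_curveBase (hC : mumford_smoothCurve_through_two_points)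
    (h : ∀ ⦃n : ℕ⦄ ⦃𝒳 S : SchemeOver ℂ⦄ (f : 𝒳 ⟶ S), IsSmoothProjectiveFamily f n →
      (∃ (N : ℕ) (ι : 𝒳 ⟶ projectiveSpace N ℂ ⊗ S), IsClosedImmersion ι.left ∧
        ι ≫ CartesianMonoidalCategory.snd (projectiveSpace N ℂ) S = f) →
      IrreducibleSpace S.left → IsAffine S.left → AlgebraicGeometry.Smooth S.hom →
      topologicalKrullDim S.left = 1 →
      ∀ (p : ℕ) (A : complexBetti 𝒳 (2 * p)),
      (∀ s : ComplexPoints S, IsRationalClass (complexBetti.map (fiberι f s) (2 * p) A) ∧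
        IsOfHodgeType n (fiberOver f s) (2 * p) p p (complexBetti.map (fiberι f s) (2 * p) A)) →
      (∃ s₀ : ComplexPoints S,
        complexBetti.map (fiberι f s₀) (2 * p) A ∈ algebraicClasses (fiberOver f s₀) p) →
      ∀ s : ComplexPoints S,
        complexBetti.map (fiberι f s) (2 * p) A ∈ algebraicClasses (fiberOver f s) p)
    ⦃n : ℕ⦄ ⦃𝒳 S : SchemeOver ℂ⦄ (f : 𝒳 ⟶ S) (hf : IsSmoothProjectiveFamily f n)
    (hι : ∃ (N : ℕ) (ι : 𝒳 ⟶ projectiveSpace N ℂ ⊗ S), IsClosedImmersion ι.left ∧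
      ι ≫ CartesianMonoidalCategory.snd (projectiveSpace N ℂ) S = f)
    (hirr : IrreducibleSpace S.left) (hsm : AlgebraicGeometry.Smooth S.hom) (p : ℕ)
    (A : complexBetti 𝒳 (2 * p))
    (hA : ∀ s : ComplexPoints S, IsRationalClass (complexBetti.map (fiberι f s) (2 * p) A) ∧
      IsOfHodgeType n (fiberOver f s) (2 * p) p p (complexBetti.map (fiberι f s) (2 * p) A))
    (hs₀ : ∃ s₀ : ComplexPoints S,
      complexBetti.map (fiberι f s₀) (2 * p) A ∈ algebraicClasses (fiberOver f s₀) p)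
    (s : ComplexPoints S) :
    complexBetti.map (fiberι f s) (2 * p) A ∈ algebraicClasses (fiberOver f s) p :=
  variationalHodge_of_curveBase_of_stable hC
    (fun 𝒳 S f => ∃ (N : ℕ) (ι : 𝒳 ⟶ projectiveSpace N ℂ ⊗ S), IsClosedImmersion ι.left ∧
      ι ≫ CartesianMonoidalCategory.snd (projectiveSpace N ℂ) S = f)
    (fun _ _ _ f g hι => exists_isClosedImmersion_familyPullback f g hι) h f hf hι hirr hsm p A hA hs₀ s

/-! ### The residual crux: middle codimensions over curves -/

/-- **The residual form of the crux.** Granted Lefschetz `(1,1)` (`hL`), hard Lefschetz on smooth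
projective varieties (`hHL`) and smooth curves through two points (`hC`), Grothendieck's variational
Hodge statement for ALL smooth projective families over ALL smooth irreducible bases follows from the
statement for families of relative dimension `n ≥ 4`, in codimensions `2 ≤ p ≤ n - 2`, over smooth
irreducible AFFINE CURVES (topological Krull dimension `1`): combine `variationalHodge_of_curveBase`
with the fibrewise Lefschetz range (`variationalHodge_conclusion_of_lefschetzRange`). This is the exact
residue a crux line has to prove; its first instance is `p = 2` over a curve of fourfolds.
[cite: VoisinHodgeI2002, Thm. 6.25 and Thm. 11.30] [cite: MumfordAV1970, §6 Lemma] -/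
theorem variationalHodge_of_residual (hL : lefschetzOneOne_rational)
    (hHL : ∀ (m : ℕ) (Y : SchemeOver ℂ), nonempty_hardLefschetzNFold m Y)
    (hC : mumford_smoothCurve_through_two_points)
    (h : ∀ ⦃n : ℕ⦄ ⦃𝒳 S : SchemeOver ℂ⦄ (f : 𝒳 ⟶ S), IsSmoothProjectiveFamily f n →
      IrreducibleSpace S.left → IsAffine S.left → AlgebraicGeometry.Smooth S.hom →
      topologicalKrullDim S.left = 1 →
      ∀ (p : ℕ), 2 ≤ p → p + 2 ≤ n → ∀ (A : complexBetti 𝒳 (2 * p)),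
      (∀ s : ComplexPoints S, IsRationalClass (complexBetti.map (fiberι f s) (2 * p) A) ∧
        IsOfHodgeType n (fiberOver f s) (2 * p) p p (complexBetti.map (fiberι f s) (2 * p) A)) →
      (∃ s₀ : ComplexPoints S,
        complexBetti.map (fiberι f s₀) (2 * p) A ∈ algebraicClasses (fiberOver f s₀) p) →
      ∀ s : ComplexPoints S,
        complexBetti.map (fiberι f s) (2 * p) A ∈ algebraicClasses (fiberOver f s) p) :
    VariationalHodge := by
  refine variationalHodge_of_curveBase hC fun n 𝒳 S f hf hirr haff hsm hdim p A hA hs₀ s => ?_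
  by_cases hp : p ≤ 1 ∨ n ≤ p + 1
  · exact variationalHodge_conclusion_of_lefschetzRange f hL hf hp A s (hHL _ _) (hA s)
  · exact h f hf hirr haff hsm hdim p (by omega) (by omega) A hA hs₀ s

end Summit.HodgeConjecture.HodgeConjecture.Theorems

end
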